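import Mathlib
import HarnessLib
import Literature.MathematicalPhysics.QuantumFieldTheory.WilsonFlow
import Literature.MathematicalPhysics.QuantumFieldTheory.LatticeGaugeStaticPotentialProofs
import Literature.MathematicalPhysics.QuantumFieldTheory.WilsonAxisSymmetry

/-!
# The Wilson flow commutes with every permutation of the coordinate axes; the flowed Wilson action is permutation invariant

HONEST FRAMING: exact (Metropolis-corrected) sampling algorithms for lattice gauge theory;
figures of merit are autocorrelation/cost numbers at stated couplings and volumes; no
continuum-physics claim.

Venture `LatticeQCDFlow` (cell pub-lqcd), sub-topic `Scoring`; FANOUT row 21 (`su3-base`: the 4-d `SU(3)` baselines are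
scored on `τ_int(Q²)` and `τ_int(t²E)` with `Q` and `E` measured AFTER Wilson flow).  NEW WORK of the cell (placement
rule), the axis-permutation companion of row 16's `Scoring/WilsonFlowReflectionCovariance.lean` (time reflection `Θ'`), over
the Literature's rigorous `SU(n)` Wilson flow on the torus (`QuantumFieldTheory/WilsonFlow.lean`: `plaquetteLoopSum`,
`wilsonFlowVF`, `wilsonFlow t U`, global existence/uniqueness `IsWilsonFlowLine.eq_wilsonFlow`, `hasDerivAt_wilsonFlow`,
gauge and translation covariance — that file lists "covariance under lattice rotations/reflections" as NOT there) and the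
Literature's coordinate permutations of the torus (`LatticeGaugeStaticPotentialProofs` (B): `sitePerm π`, `edgePerm π`,
`configPerm π` with `(configPerm π U)(x, μ) = U(π⁻¹x, π⁻¹μ)`, `plaquetteHolonomy_configPerm`, `wilsonAction_configPerm`,
`wilsonExpectation_comp_configPerm`).  Def-free; nothing is cited as a fact.  Printed counterpart, NAMED ONLY:
Lüscher, JHEP 08 (2010) 071, §1–§3 (the flow preserves the symmetries of the lattice theory).

## What is proved (torus `(ℤ/L)^d`, every `d`, `n`, `L ≥ 1`, every axis permutation `π`)

* §1 **`plaquetteLoopSum_configPerm`** — `Ω_{x,μ}(configPerm π V) = Ω_{π⁻¹x, π⁻¹μ}(V)` (the sum over the directions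
  `ν ≠ μ` is relabelled by `π`; no link is reversed); **`wilsonFlowVF_configPerm`** — the flow vector field is
  permutation-equivariant: `Z(configPerm π V)(x, μ) = Z(V)(π⁻¹x, π⁻¹μ)`.
* §2 **`wilsonFlow_configPerm`** — THE WILSON FLOW COMMUTES WITH EVERY AXIS PERMUTATION:
  `V_t(configPerm π U) = configPerm π (V_t U)` for every real `t` (`t ↦ configPerm π (V_t U)` solves the flow equation
  through `configPerm π U`, so it IS the flow by uniqueness).
* §3 consequences: **`wilsonAction_wilsonFlow_configPerm`** — the flowed Wilson action (the plaquette discretisation of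
  the flowed energy `E(t)` up to normalisation) is permutation invariant, `S_W(ρ, V_t(configPerm π U)) = S_W(ρ, V_t U)`
  (any continuous representation `ρ` of `SU(n)` read on the flowed links); **`wilsonExpectation_comp_wilsonFlow_configPerm`**
  — `⟨F(configPerm π (V_t U))⟩_{Λ,β} = ⟨F(V_t U)⟩_{Λ,β}` for every observable `F` of the flowed field, every real `β`, `t`.
With row 16's `wilsonFlow_negReflect` the flow is now known in the tree to commute with the axis permutations and the time
reflection, which generate the symmetry group of the hypercube acting on the torus.
Sequel (once `Exactness/AxisPermutationSymmetry` is built): the flowed clover charge density flips sign under the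
transposition `1 ↔ 2` and the flowed slab charges of the open lattice have symmetric laws.

NOT CLAIMED: reflections of a single axis other than through `Θ'` and permutations; the `U(N)` / general-`G` matrix-level
flow of `QuantumLattice/LatticeWilsonFlow`; anything about the clover observables here; any number.
-/

noncomputable section

open Matrix MeasureTheory
open Literature.MathematicalPhysics.QuantumFieldTheory

namespace Summit.Ventures.LatticeQCDFlow.Scoring

/-! ## §1 `Ω` and the flow vector field under an axis permutation -/

section VectorField

variable {d L n : ℕ} (π : Equiv.Perm (Fin d))

/-- **`Ω_{x,μ}(configPerm π V) = Ω_{π⁻¹x, π⁻¹μ}(V)`**: the loop sum through a link of the permuted configuration is the loop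
sum of the original configuration through the permuted link (relabel the transverse directions by `π`). -/
theorem plaquetteLoopSum_configPerm (V : GaugeConfig d L (Matrix.specialUnitaryGroup (Fin n) ℂ)) (x : Site d L)
    (μ : Fin d) :
    plaquetteLoopSum (configPerm π V) x μ = plaquetteLoopSum V (sitePerm π.symm x) (π.symm μ) := by
  have hsub : ∀ (y : Site d L) (ν : Fin d),
      sitePerm π.symm (y - Pi.single ν 1) = sitePerm π.symm y - Pi.single (π.symm ν) 1 := fun y ν => by
    rw [sub_eq_add_neg, ← Pi.single_neg, sitePerm_add, sitePerm_single, Pi.single_neg, ← sub_eq_add_neg]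
  unfold plaquetteLoopSum
  simp only [plaquetteHolonomy_configPerm, configPerm_apply, hsub]
  exact Fintype.sum_equiv π.symm _ _ fun ν => by simp only [EmbeddingLike.apply_eq_iff_eq]

/-- **The flow vector field is permutation-equivariant**: `Z(configPerm π V)(x, μ) = Z(V)(π⁻¹x, π⁻¹μ)`. -/
theorem wilsonFlowVF_configPerm (V : GaugeConfig d L (Matrix.specialUnitaryGroup (Fin n) ℂ)) (e : Edge d L) :
    wilsonFlowVF (configPerm π V) e = wilsonFlowVF V (sitePerm π.symm e.1, π.symm e.2) := by
  obtain ⟨x, μ⟩ := e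
  simp only [wilsonFlowVF, plaquetteLoopSum_configPerm, configPerm_apply]

end VectorField

/-! ## §2 The flow commutes with axis permutations -/

section Flow

variable {d L n : ℕ} [NeZero L] (π : Equiv.Perm (Fin d))

/-- **THE WILSON FLOW COMMUTES WITH EVERY PERMUTATION OF THE COORDINATE AXES**: `V_t(configPerm π U) = configPerm π (V_t U)`
for every `SU(n)` configuration `U` of the torus `(ℤ/L)^d` and every real flow time `t`.  Proof: `t ↦ configPerm π (V_t U)` is
a global flow line through `configPerm π U` (`wilsonFlowVF_configPerm`), and global flow lines are unique
(`IsWilsonFlowLine.eq_wilsonFlow`). -/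
theorem wilsonFlow_configPerm (t : ℝ) (U : GaugeConfig d L (Matrix.specialUnitaryGroup (Fin n) ℂ)) :
    wilsonFlow t (configPerm π U) = configPerm π (wilsonFlow t U) := by
  have h : IsWilsonFlowLine (configPerm π U) (fun t => configPerm π (wilsonFlow t U)) := by
    refine ⟨by simp only [wilsonFlow_zero], fun t e i j => ?_⟩
    rw [wilsonFlowVF_configPerm]
    simp only [configPerm_apply]
    exact hasDerivAt_wilsonFlow U t (sitePerm π.symm e.1, π.symm e.2) i j
  exact (h.eq_wilsonFlow t).symm

/-- The inverse reading: `V_t U = configPerm π⁻¹ (V_t (configPerm π U))`. -/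
theorem wilsonFlow_eq_configPerm_symm (t : ℝ) (U : GaugeConfig d L (Matrix.specialUnitaryGroup (Fin n) ℂ)) :
    wilsonFlow t U = configPerm π.symm (wilsonFlow t (configPerm π U)) := by
  rw [wilsonFlow_configPerm]
  funext e
  simp only [configPerm_apply, Equiv.symm_symm]
  congr 1
  ext k
  · simp only [sitePerm_apply, Equiv.symm_symm, Equiv.symm_apply_apply]
  · simp only [Equiv.symm_apply_apply]

end Flow

/-! ## §3 The flowed Wilson action is permutation invariant; Wilson means of flowed observables -/

section Consequences

variable {d L n N : ℕ} [NeZero L] (π : Equiv.Perm (Fin d))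
  (ρ : Matrix.specialUnitaryGroup (Fin n) ℂ →* Matrix (Fin N) (Fin N) ℂ)

/-- **The flowed Wilson action is invariant under every axis permutation**: `S_W(ρ, V_t(configPerm π U)) = S_W(ρ, V_t U)`
(continuous `ρ`; the plaquette discretisation of the flowed energy `E(t)` up to normalisation). -/
theorem wilsonAction_wilsonFlow_configPerm (hρ : Continuous ρ) (t : ℝ)
    (U : GaugeConfig d L (Matrix.specialUnitaryGroup (Fin n) ℂ)) :
    wilsonAction ρ (wilsonFlow t (configPerm π U)) = wilsonAction ρ (wilsonFlow t U) := by
  rw [wilsonFlow_configPerm, wilsonAction_configPerm ρ hρ]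

/-- **`⟨F(configPerm π (V_t U))⟩_{Λ,β} = ⟨F(V_t U)⟩_{Λ,β}`** for every observable `F` of the flowed field, every real `β`
and flow time `t`: the Wilson measure is permutation invariant (Literature) and the flow commutes with the permutation. -/
theorem wilsonExpectation_comp_wilsonFlow_configPerm (hρ : Continuous ρ) (β t : ℝ) {V : Type*} [NormedAddCommGroup V]
    [NormedSpace ℝ V] (F : GaugeConfig d L (Matrix.specialUnitaryGroup (Fin n) ℂ) → V) :
    wilsonExpectation ρ β (fun U => F (configPerm π (wilsonFlow t U))) = wilsonExpectation ρ β (fun U => F (wilsonFlow t U)) := by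
  have h := wilsonExpectation_comp_configPerm ρ hρ β π (fun U => F (wilsonFlow t U))
  simp only [Function.comp_def, wilsonFlow_configPerm] at h
  exact h

end Consequences

end Summit.Ventures.LatticeQCDFlow.Scoring
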